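import Literature.NumberTheory.Transcendental.CijsouwWaldschmidt1977Liouville
import HarnessLib

/-!
# Waldschmidt 1980, Lemma 2.2 in `ℚ(√α₁, …, √αₖ)`: the SHARP Liouville inequality (exponent `2ᵏ`)

Support file (theorems only; no definitions, no named facts) for the archimedean input of the
Stewart–Yu 1991 line of `Literature.Barriers.ABC.stewartYu1991_upperBound` (M. Waldschmidt,
*A lower bound for linear forms in logarithms*, Acta Arith. **37** (1980), §3 over `ℚ`, `q = 2`).

In the main inductive argument the values `φ_{J,τ}(s/q)` lie in `K₁ = ℚ(√α₁, …, √αₖ)`, a field of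
degree `2ᵏ`, and Lemma 3.4 (3.22) (p. 269–270) bounds them below by Lemma 2.2 (the Liouville
inequality `|P(θ)| ≥ L(P)^{1−d} exp(−d ∑ Nₖ h(θₖ))`, `d = [K₁ : ℚ] = 2ᵏ`): the degree enters
LINEARLY in the exponent, `−log |φ(s/q)| ≤ (qⁿD − 1)(log d + log(length)) + ⋯`. The tree's
`CW77.abs_ev_ge` (Cijsouw–Waldschmidt's Lemma 10 over `ℚ`) proves such a bound by the tower
`ℚ ⊂ ℚ(√α₁) ⊂ ⋯` with exponent `4^{k+1}`, which is enough for Cijsouw–Waldschmidt's constants but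
a factor `2^{k+2}` too weak for Waldschmidt's `n^n`. Here the same induction (same objects `CW77.ev`,
`cmul`, `lo`, `hi`, `conjLast`, `heightProd`) is run with the sharp potential:

* `abs_ev_ge_sharp`: if the positive rationals `αⱼ` have independent square classes, `c ≠ 0`,
  `D c_S ∈ ℤ`, `∑ |c_S| ≤ M` (`D, M ≥ 1`), then
  `|∑_S c_S ∏_{j∈S} √αⱼ| ≥ M / (4 D M (∏ⱼ H(αⱼ))²)^{2ᵏ}`, `H(q) = max(|num q|, den q)`.

(At each level `x x̄ = u² − αₖ v²` has denominator `≤ D² P H` and length `≤ 2 H P M²`, and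
`|x̄| ≤ H M P`; the potential `M/(4 D M P²)^{2ᵏ}` reproduces itself with `P ↦ P H`.)

## References

* [Waldschmidt1980] M. Waldschmidt, *A lower bound for linear forms in logarithms*, Acta Arith. 37
  (1980), 257–283 — Lemma 2.2 (p. 261), (3.22) and its proof (pp. 269–270).
* [CijsouwWaldschmidt1977] P. L. Cijsouw, M. Waldschmidt, Compositio Math. 34 (1977) — Lemma 10
  (p. 188) (the tree's `CW77.abs_ev_ge`, whose induction is reused).
-/

noncomputable section

open Finset

namespace Literature.NumberTheory.Transcendental.Waldschmidt1980

open CW77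

/-- The numerical step of the sharp induction: from
`M''/(4 D'' M'' P²)^E ≤ x · z` with `D'' ≤ D² P H`, `M'' = 2 H P M²`, `0 < z ≤ H M P` we get
`M / (4 D M (P H)²)^{2E} ≤ x`. [folklore] -/
theorem numeric_step_sharp {D M H P x z D'' : ℝ} {E : ℕ} (hD : 1 ≤ D) (hM : 1 ≤ M) (hH : 1 ≤ H)
    (hP : 1 ≤ P) (hD''1 : 1 ≤ D'') (hD'' : D'' ≤ D ^ 2 * P * H)
    (hy : (2 * H * P * M ^ 2) / (4 * D'' * (2 * H * P * M ^ 2) * P ^ 2) ^ E ≤ x * z)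
    (hz : 0 < z) (hzle : z ≤ H * M * P) :
    M / (4 * D * M * (P * H) ^ 2) ^ (2 * E) ≤ x := by
  have hDMPH : 1 ≤ 4 * D * M * (P * H) ^ 2 := by
    have h1 : 1 ≤ (P * H) ^ 2 := one_le_pow₀ (one_le_mul_of_one_le_of_one_le hP hH)
    have := one_le_mul_of_one_le_of_one_le (one_le_mul_of_one_le_of_one_le hD hM) h1
    nlinarith
  -- the base of the old potential is at most the square of the new base
  have hbase : 4 * D'' * (2 * H * P * M ^ 2) * P ^ 2 ≤ (4 * D * M * (P * H) ^ 2) ^ 2 := by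
    have h1 : 4 * D'' * (2 * H * P * M ^ 2) * P ^ 2 ≤ 4 * (D ^ 2 * P * H) * (2 * H * P * M ^ 2) * P ^ 2 := by
      have : 0 ≤ (2 * H * P * M ^ 2) * P ^ 2 := by positivity
      nlinarith
    have h2 : 4 * (D ^ 2 * P * H) * (2 * H * P * M ^ 2) * P ^ 2 = 8 * D ^ 2 * M ^ 2 * P ^ 4 * H ^ 2 := by
      ring
    have h3 : (4 * D * M * (P * H) ^ 2) ^ 2 = 16 * D ^ 2 * M ^ 2 * P ^ 4 * H ^ 4 := by ring
    rw [h2] at h1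
    rw [h3]
    have h4 : 8 * D ^ 2 * M ^ 2 * P ^ 4 * H ^ 2 ≤ 16 * D ^ 2 * M ^ 2 * P ^ 4 * H ^ 4 := by
      have hH2 : 1 ≤ H ^ 2 := one_le_pow₀ hH
      have h0 : 0 ≤ 8 * D ^ 2 * M ^ 2 * P ^ 4 * H ^ 2 := by positivity
      nlinarith
    linarith
  have hpos'' : 0 < 4 * D'' * (2 * H * P * M ^ 2) * P ^ 2 := by positivity
  have hpow : (4 * D'' * (2 * H * P * M ^ 2) * P ^ 2) ^ E ≤ (4 * D * M * (P * H) ^ 2) ^ (2 * E) := by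
    rw [pow_mul]
    exact pow_le_pow_left₀ hpos''.le hbase E
  -- `x ≥ (M''/old^E)/z ≥ (2HPM²/new^{2E})/(HMP) = 2M/new^{2E}`
  have hx : (2 * H * P * M ^ 2) / (4 * D'' * (2 * H * P * M ^ 2) * P ^ 2) ^ E / z ≤ x := by
    rw [div_le_iff₀ hz]; exact hy
  refine le_trans ?_ hx
  rw [le_div_iff₀ hz]
  have hnewpos : 0 < (4 * D * M * (P * H) ^ 2) ^ (2 * E) := by positivity
  have holdpos : 0 < (4 * D'' * (2 * H * P * M ^ 2) * P ^ 2) ^ E := by positivity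
  calc M / (4 * D * M * (P * H) ^ 2) ^ (2 * E) * z
      ≤ M / (4 * D * M * (P * H) ^ 2) ^ (2 * E) * (H * M * P) :=
        mul_le_mul_of_nonneg_left hzle (by positivity)
    _ ≤ (2 * H * P * M ^ 2) / (4 * D * M * (P * H) ^ 2) ^ (2 * E) := by
        rw [div_mul_eq_mul_div, div_le_div_iff_of_pos_right hnewpos]
        have : 0 ≤ H * P * M ^ 2 := by positivity
        nlinarith
    _ ≤ (2 * H * P * M ^ 2) / (4 * D'' * (2 * H * P * M ^ 2) * P ^ 2) ^ E :=
        div_le_div_of_nonneg_left (by positivity) holdpos hpow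

set_option maxHeartbeats 800000 in
/-- **The sharp Liouville inequality in `ℚ(√α₁, …, √αₖ)`** (Waldschmidt's Lemma 2.2 for the values
`φ_{J,τ}(s/2)`; Cijsouw–Waldschmidt's Lemma 10 with the exponent `2ᵏ = [K₁ : ℚ]` instead of `4^{k+1}`):
if the positive rationals `αⱼ` have independent square classes, `c ≠ 0`, `D c_S ∈ ℤ` for all `S` and
`∑ |c_S| ≤ M` (`D, M ≥ 1`), then
`M / (4 D M (∏ⱼ H(αⱼ))²)^{2ᵏ} ≤ |∑_S c_S ∏_{j ∈ S} √αⱼ|`.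
[cite: Waldschmidt1980, Lemma 2.2 (p. 261) and (3.22) (pp. 269–270)] -/
theorem abs_ev_ge_sharp : ∀ (k : ℕ) (α : Fin k → ℚ), (∀ j, 0 < α j) →
    (∀ T : Finset (Fin k), T.Nonempty → ¬ IsSquare (∏ j ∈ T, α j)) →
    ∀ (c : Finset (Fin k) → ℚ), c ≠ 0 → ∀ (D : ℕ), 1 ≤ D → (∀ S, ∃ z : ℤ, (D : ℚ) * c S = z) →
    ∀ (M : ℝ), 1 ≤ M → ∑ S, |(c S : ℝ)| ≤ M →
    M / (4 * D * M * heightProd α ^ 2) ^ (2 ^ k) ≤ |ev α c| := by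
  intro k
  induction k with
  | zero =>
    intro α hα hind c hc D hD hden M hM hcM
    -- `ev α c = c ∅`, a non-zero rational with denominator `≤ D`: `|ev| ≥ 1/D ≥ M/(4DM)`
    have huniv : (univ : Finset (Finset (Fin 0))) = {∅} := by
      ext S
      simp only [Finset.mem_univ, Finset.mem_singleton, true_iff]
      exact Finset.eq_empty_of_isEmpty S
    have hev : ev α c = (c ∅ : ℝ) := by
      unfold ev
      rw [huniv, Finset.sum_singleton]
      unfold mono
      rw [Finset.prod_empty, mul_one]
    have hc0 : c ∅ ≠ 0 := by
      intro h; apply hc; funext S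
      have : S = ∅ := Finset.eq_empty_of_isEmpty S
      rw [this, h]; rfl
    obtain ⟨z, hz⟩ := hden ∅
    have hz0 : z ≠ 0 := by
      rintro rfl
      rw [Int.cast_zero, mul_eq_zero] at hz
      rcases hz with h | h
      · exact absurd (by exact_mod_cast h : D = 0) (by omega)
      · exact hc0 h
    have hz1 : (1 : ℝ) ≤ |(z : ℝ)| := by exact_mod_cast Int.one_le_abs hz0
    have hD0 : (0 : ℝ) < D := by exact_mod_cast hD
    have hcz : (c ∅ : ℝ) = z / D := by
      have : ((D : ℚ) * c ∅ : ℚ) = (z : ℚ) := hz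
      have h' : (D : ℝ) * (c ∅ : ℝ) = z := by exact_mod_cast this
      field_simp; linarith
    rw [hev, hcz, abs_div, abs_of_pos hD0]
    have hP : heightProd α = 1 := by unfold heightProd; simp
    rw [hP, one_pow, mul_one, pow_zero, pow_one]
    -- `M/(4DM) = 1/(4D) ≤ 1/D ≤ |z|/D`
    have hM0 : 0 < M := by linarith
    calc M / (4 * (D : ℝ) * M) = 1 / (4 * D) := by field_simp
      _ ≤ 1 / D := one_div_le_one_div_of_le hD0 (by linarith)
      _ ≤ |(z : ℝ)| / D := by rw [le_div_iff₀ hD0]; field_simp; exact hz1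
  | succ k ih =>
    intro α' hα' hind c hc D hD hden M hM hcM
    have hα'0 : ∀ j, 0 ≤ α' j := fun j => (hα' j).le
    set a : ℚ := α' (Fin.last k) with ha
    set α : Fin k → ℚ := init α' with hαdef
    have hα : ∀ j, 0 < α j := fun j => hα' _
    have hα0 : ∀ j, 0 ≤ α j := fun j => (hα j).le
    have hindα : ∀ T : Finset (Fin k), T.Nonempty → ¬ IsSquare (∏ j ∈ T, α j) := hind_init α' hind
    set H : ℝ := hgt a with hH
    set P : ℝ := heightProd α with hP
    have hH1 : 1 ≤ H := one_le_hgt a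
    have hP1 : 1 ≤ P := one_le_heightProd α
    have hP' : heightProd α' = P * H := by
      rw [hP, hH, ha]; unfold heightProd; rw [Fin.prod_univ_castSucc]
    have hD1 : (1 : ℝ) ≤ D := by exact_mod_cast hD
    set u : ℝ := ev α (lo c) with hu
    set v : ℝ := ev α (hi c) with hv
    set r : ℝ := Real.sqrt (a : ℝ) with hr
    have ha0 : (0 : ℝ) ≤ a := by exact_mod_cast hα'0 (Fin.last k)
    have hr0 : 0 ≤ r := Real.sqrt_nonneg _
    have hrr : r * r = a := Real.mul_self_sqrt ha0
    have hx : ev α' c = u + r * v := ev_succ α' c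
    -- sums of the parts
    have hsum := sum_abs_succ c
    have hlo_le : ∑ S, |(lo c S : ℝ)| ≤ M := by
      have : 0 ≤ ∑ S, |(hi c S : ℝ)| := Finset.sum_nonneg fun S _ => abs_nonneg _
      linarith
    have hhi_le : ∑ S, |(hi c S : ℝ)| ≤ M := by
      have : 0 ≤ ∑ S, |(lo c S : ℝ)| := Finset.sum_nonneg fun S _ => abs_nonneg _
      linarith
    have hden_lo : ∀ S, ∃ z : ℤ, (D : ℚ) * lo c S = z := fun S => hden _
    have hden_hi : ∀ S, ∃ z : ℤ, (D : ℚ) * hi c S = z := fun S => hden _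
    -- the new base dominates the old one
    have hM0 : 0 < M := by linarith
    have hbase1 : 1 ≤ 4 * (D : ℝ) * M * P ^ 2 := by
      have h1 : 1 ≤ P ^ 2 := one_le_pow₀ hP1
      have := one_le_mul_of_one_le_of_one_le (one_le_mul_of_one_le_of_one_le hD1 hM) h1
      nlinarith
    have hbase_le : 4 * (D : ℝ) * M * P ^ 2 ≤ 4 * D * M * (P * H) ^ 2 := by
      have h1 : P ^ 2 ≤ (P * H) ^ 2 := by
        rw [mul_pow]; exact le_mul_of_one_le_right (by positivity) (one_le_pow₀ hH1)
      exact mul_le_mul_of_nonneg_left h1 (by positivity)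
    have hE : 2 ^ (k + 1) = 2 * 2 ^ k := by ring
    rcases eq_or_ne (hi c) 0 with hhi0 | hhi0
    · -- no `√αₖ`: the induction hypothesis for `lo c`
      have hlo0 : lo c ≠ 0 := (lo_hi_ne_zero hc).resolve_right (fun h => h hhi0)
      have key := ih α hα hindα (lo c) hlo0 D hD hden_lo M hM hlo_le
      have hv0 : v = 0 := by rw [hv, hhi0, ev_zero]
      have hx' : ev α' c = u := by rw [hx, hv0]; ring
      rw [hx']
      refine le_trans ?_ key
      rw [hP']
      apply div_le_div_of_nonneg_left hM0.le (by positivity)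
      calc (4 * (D : ℝ) * M * P ^ 2) ^ 2 ^ k ≤ (4 * D * M * (P * H) ^ 2) ^ 2 ^ k :=
            pow_le_pow_left₀ (by positivity) hbase_le _
        _ ≤ (4 * D * M * (P * H) ^ 2) ^ 2 ^ (k + 1) :=
            pow_le_pow_right₀ (hbase1.trans hbase_le) (Nat.pow_le_pow_right (by norm_num) (by omega))
    · -- the conjugate and the norm
      set c'' : Finset (Fin k) → ℚ := cmul α (lo c) (lo c) - a • cmul α (hi c) (hi c) with hc''
      have hev'' : ev α c'' = u * u - (a : ℝ) * (v * v) := by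
        rw [hc'', ev_sub, ev_smul, ev_cmul α hα0, ev_cmul α hα0]
      have hxbar : ev α' (conjLast c) = u - r * v := ev_conjLast α' c
      have hxbar0 : ev α' (conjLast c) ≠ 0 := ev_ne_zero α' hα'0 hind (conjLast_ne_zero hc)
      have hx0 : ev α' c ≠ 0 := ev_ne_zero α' hα'0 hind hc
      have hnorm : ev α' c * ev α' (conjLast c) = ev α c'' := by
        rw [hx, hxbar, hev'', ← hrr]; ring
      have hc''0 : c'' ≠ 0 := by
        intro h0
        have : ev α c'' = 0 := by rw [h0, ev_zero]
        rw [← hnorm] at this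
        rcases mul_eq_zero.mp this with h | h
        · exact hx0 h
        · exact hxbar0 h
      -- denominators and sizes of `c''`
      set Dd : ℕ := D * D * ∏ j, (α j).den with hDd
      set D'' : ℕ := Dd * a.den with hD''
      have hden'' : ∀ U, ∃ z : ℤ, (D'' : ℚ) * c'' U = z := by
        intro U
        obtain ⟨z₁, hz₁⟩ := exists_int_cmul α (lo c) (lo c) hden_lo hden_lo U
        obtain ⟨z₂, hz₂⟩ := exists_int_cmul α (hi c) (hi c) hden_hi hden_hi U
        refine ⟨a.den * z₁ - a.num * z₂, ?_⟩
        rw [hc'', hD'']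
        simp only [Pi.sub_apply, Pi.smul_apply, smul_eq_mul]
        push_cast
        rw [← hDd] at hz₁ hz₂
        have ha' : (a.den : ℚ) * a = a.num := by rw [mul_comm]; exact Rat.mul_den_eq_num a
        calc ((Dd : ℚ) * a.den) * (cmul α (lo c) (lo c) U - a * cmul α (hi c) (hi c) U)
            = (a.den : ℚ) * ((Dd : ℚ) * cmul α (lo c) (lo c) U) -
              ((a.den : ℚ) * a) * ((Dd : ℚ) * cmul α (hi c) (hi c) U) := by ring
          _ = (a.den : ℚ) * z₁ - (a.num : ℚ) * z₂ := by rw [hz₁, hz₂, ha']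
      have hD''1 : 1 ≤ D'' := by
        rw [hD'', hDd]
        have h1 : 1 ≤ ∏ j, (α j).den := Finset.one_le_prod' fun j _ => (α j).pos
        have := a.pos
        have : 1 ≤ D * D := Nat.one_le_iff_ne_zero.mpr (by positivity)
        exact Nat.one_le_iff_ne_zero.mpr (by positivity)
      have hD''le : (D'' : ℝ) ≤ D ^ 2 * P * H := by
        rw [hD'', hDd]; push_cast
        have h1 : ((∏ j, ((α j).den : ℝ))) ≤ P := by
          have := prod_den_le α; push_cast at this; exact this
        have h2 : ((a.den : ℝ)) ≤ H := den_le_hgt a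
        calc (D : ℝ) * D * (∏ j, ((α j).den : ℝ)) * a.den ≤ (D : ℝ) * D * P * H :=
            mul_le_mul (mul_le_mul_of_nonneg_left h1 (by positivity)) h2 (by positivity) (by positivity)
          _ = (D : ℝ) ^ 2 * P * H := by ring
      set M'' : ℝ := 2 * H * P * M ^ 2 with hM''
      have hPabs : ∏ j, max 1 |(α j : ℝ)| ≤ P := prod_max_one_abs_le α
      have hc''M : ∑ U, |(c'' U : ℝ)| ≤ M'' := by
        have h1 := l1_cmul_le α (lo c) (lo c)
        have h2 := l1_cmul_le α (hi c) (hi c)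
        have hlo2 : (∑ S, |(lo c S : ℝ)|) * ∑ S, |(lo c S : ℝ)| ≤ M ^ 2 := by
          rw [sq]; exact mul_le_mul hlo_le hlo_le (Finset.sum_nonneg fun _ _ => abs_nonneg _) (by linarith)
        have hhi2 : (∑ S, |(hi c S : ℝ)|) * ∑ S, |(hi c S : ℝ)| ≤ M ^ 2 := by
          rw [sq]; exact mul_le_mul hhi_le hhi_le (Finset.sum_nonneg fun _ _ => abs_nonneg _) (by linarith)
        have hA : ∑ U, |(cmul α (lo c) (lo c) U : ℝ)| ≤ P * M ^ 2 :=
          h1.trans (mul_le_mul hPabs hlo2 (by positivity) (by positivity))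
        have hB : ∑ U, |(cmul α (hi c) (hi c) U : ℝ)| ≤ P * M ^ 2 :=
          h2.trans (mul_le_mul hPabs hhi2 (by positivity) (by positivity))
        have haH : |(a : ℝ)| ≤ H := abs_le_hgt a
        calc ∑ U, |(c'' U : ℝ)| ≤ ∑ U, (|(cmul α (lo c) (lo c) U : ℝ)| + |(a : ℝ)| * |(cmul α (hi c) (hi c) U : ℝ)|) := by
              refine Finset.sum_le_sum fun U _ => ?_
              rw [hc'']
              simp only [Pi.sub_apply, Pi.smul_apply, smul_eq_mul, Rat.cast_sub, Rat.cast_mul]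
              calc |(cmul α (lo c) (lo c) U : ℝ) - (a : ℝ) * cmul α (hi c) (hi c) U|
                  ≤ |(cmul α (lo c) (lo c) U : ℝ)| + |(a : ℝ) * cmul α (hi c) (hi c) U| := abs_sub _ _
                _ = _ := by rw [abs_mul]
          _ = ∑ U, |(cmul α (lo c) (lo c) U : ℝ)| + |(a : ℝ)| * ∑ U, |(cmul α (hi c) (hi c) U : ℝ)| := by
              rw [Finset.sum_add_distrib, Finset.mul_sum]
          _ ≤ P * M ^ 2 + H * (P * M ^ 2) := add_le_add hA (mul_le_mul haH hB (by positivity) (by positivity))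
          _ ≤ M'' := by
              have : P * M ^ 2 ≤ H * (P * M ^ 2) := le_mul_of_one_le_left (by positivity) hH1
              rw [hM'']; linarith
      have hM''1 : 1 ≤ M'' := by
        rw [hM'']
        have h1 : 1 ≤ H * P * M ^ 2 :=
          one_le_mul_of_one_le_of_one_le (one_le_mul_of_one_le_of_one_le hH1 hP1) (one_le_pow₀ hM)
        linarith
      -- the induction hypothesis for `c''`
      have key := ih α hα hindα c'' hc''0 D'' hD''1 hden'' M'' hM''1 hc''M
      -- `|x̄| ≤ H M P`
      have hPs : ∏ j, max 1 (Real.sqrt (α j : ℝ)) ≤ P := prod_max_one_sqrt_le α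
      have hxbar_le : |ev α' (conjLast c)| ≤ H * M * P := by
        rw [hxbar]
        have hu_le : |u| ≤ (∑ S, |(lo c S : ℝ)|) * P :=
          (abs_ev_le α (lo c)).trans (mul_le_mul_of_nonneg_left hPs (Finset.sum_nonneg fun _ _ => abs_nonneg _))
        have hv_le : |v| ≤ (∑ S, |(hi c S : ℝ)|) * P :=
          (abs_ev_le α (hi c)).trans (mul_le_mul_of_nonneg_left hPs (Finset.sum_nonneg fun _ _ => abs_nonneg _))
        have hrH : r ≤ H := (le_max_right 1 r).trans (max_one_sqrt_le_hgt a)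
        have h0lo : 0 ≤ ∑ S, |(lo c S : ℝ)| := Finset.sum_nonneg fun _ _ => abs_nonneg _
        have h0hi : 0 ≤ ∑ S, |(hi c S : ℝ)| := Finset.sum_nonneg fun _ _ => abs_nonneg _
        calc |u - r * v| ≤ |u| + |r * v| := abs_sub _ _
          _ = |u| + r * |v| := by rw [abs_mul, abs_of_nonneg hr0]
          _ ≤ (∑ S, |(lo c S : ℝ)|) * P + r * ((∑ S, |(hi c S : ℝ)|) * P) :=
              add_le_add hu_le (mul_le_mul_of_nonneg_left hv_le hr0)
          _ ≤ H * ((∑ S, |(lo c S : ℝ)|) * P) + H * ((∑ S, |(hi c S : ℝ)|) * P) := by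
              apply add_le_add
              · exact le_mul_of_one_le_left (by positivity) hH1
              · exact mul_le_mul_of_nonneg_right hrH (by positivity)
          _ = H * P * (∑ S, |(c S : ℝ)|) := by rw [hsum]; ring
          _ ≤ H * P * M := mul_le_mul_of_nonneg_left hcM (by positivity)
          _ = H * M * P := by ring
      -- assemble
      have hxyz : |ev α c''| = |ev α' c| * |ev α' (conjLast c)| := by
        rw [← abs_mul, hnorm]
      have hy : M'' / (4 * (D'' : ℝ) * M'' * P ^ 2) ^ 2 ^ k ≤ |ev α' c| * |ev α' (conjLast c)| := by
        rw [← hxyz, hP]; exact key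
      rw [hP', hE]
      exact numeric_step_sharp hD1 hM hH1 hP1 (by exact_mod_cast hD''1) hD''le
        (by rw [hM''] at hy; exact hy) (abs_pos.mpr hxbar0) hxbar_le

end Literature.NumberTheory.Transcendental.Waldschmidt1980
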